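import Summits.AtomisticToContinuum.FouriersLaw.Theses.HeatModeWeylLaw

/-!
# `HeatModeWeylLaw.Assembly` — PROVED

Route `AtomisticToContinuum/FouriersLaw/HeatModeWeylLaw`, assembly item
`stmt-AtomisticToContinuum-13587` (`Assembly`):

  `HeatModeGap → SineModeDiffusive → WeylLimit → EinsteinRelation → SineModeBasics →
   SpecificHeatLimit → NessUnique → PinnedSteadyStateExists → FiniteResponseOfUnique → FouriersLaw`.

The route file carries the planner-authored, sorry-free D-0027 §2.1 deciding theorem
`Summit.AtomisticToContinuum.FouriersLaw.Theses.HeatModeWeylLaw.closes`, whose type is literally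
the body of `Assembly`; this file records the item-closing theorem whose type is the route decl
`Assembly` by name.  For the mathematics (clause (i) of `FouriersLawFor` from existence
`PinnedSteadyStateExists` plus weak-NESS uniqueness `NessUnique`; clause (ii): `WeylLimit` gives
`D_th ≥ 0` and a branch, the faster-than-diffusive branch contradicts `SineModeDiffusive` +
`SineModeBasics` at `s₀ = 1/(2(|C|+1))`, in the diffusive branch `HeatModeGap` forces `D_th > 0`,
`κ(T) := c_v · D_th` with `c_v > 0` from `SpecificHeatLimit`, `D_N` from `FiniteResponseOfUnique`
and `D_N → κ(T)` by `EinsteinRelation`, glued over `T` by choice) see the docstring of `closes` in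
the route file.  No named-fact hypotheses: the theorem is unconditional (its axioms are those of
`closes`: `propext`, `Classical.choice`, `Quot.sound`).
-/

namespace Summit.AtomisticToContinuum.FouriersLaw.Theorems

/-- Settles `stmt-AtomisticToContinuum-13587` (assembly of route `HeatModeWeylLaw`): the four cruxes
`HeatModeGap` (L), `SineModeDiffusive` (U), `WeylLimit` (W), `EinsteinRelation` (H), the equilibrium
supports `SineModeBasics`, `SpecificHeatLimit`, weak steady-state uniqueness `NessUnique`, existence
`PinnedSteadyStateExists` and the finite-`N` response limits `FiniteResponseOfUnique` imply the
sub-problem statement `FouriersLaw`.  Proof: the route's deciding theorem `closes` (after unfolding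
`Assembly`). [folklore] -/
theorem heatModeWeylLaw_assembly_proof :
    Summit.AtomisticToContinuum.FouriersLaw.Theses.HeatModeWeylLaw.Assembly := by
  unfold Summit.AtomisticToContinuum.FouriersLaw.Theses.HeatModeWeylLaw.Assembly
  exact Summit.AtomisticToContinuum.FouriersLaw.Theses.HeatModeWeylLaw.closes

end Summit.AtomisticToContinuum.FouriersLaw.Theorems
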